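import Mathlib
import Literature.MathematicalPhysics.QuantumFieldTheory.TwistedPartitionFunction
import Literature.MathematicalPhysics.QuantumFieldTheory.WilsonAxisSymmetry
import Literature.MathematicalPhysics.QuantumFieldTheory.YangMillsOS
import HarnessLib

/-!
# Sketch — crux idea `thooft-rotation-blindness` for `ConvexGribovBody.NonSimplyConnectedLatticeGap`
(crux item stmt-QuantumFields-16405; ideator 2, round 1)

First checkable statements of the line, typed over EXISTING declarations
(`twistedPartitionFunction`, `insertedWilsonAction`, `insertedPartitionFunction`, `stackInsertion`,
`configPerm`, `haarProbability`). Nothing here is a route item; nothing is asserted as true except the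
two elementary lemmas that are proved (`electricSuppression_blindness`, `softSplit_sum`).

* `twistedExpectation` — expectation of an observable under the Wilson weight with a central
  plaquette insertion `t` ('t Hooft twist = `stackInsertion z q a b`).
* `TwistWeightPlaneIndependent` (Prop) — 't Hooft's Euclidean covariance on the SYMMETRIC torus
  `(ℤ/L)^4`: `Z(z; q)` does not depend on the twisted plane `q` ("magnetic-twist weight =
  temporal-twist weight"; 't Hooft 1979/1980 duality by a 90° rotation).
* `TwistPlaneExchange` (Prop) — the FIRST LEMMA of the card: the twisted expectation of any bounded
  measurable observable in plane `q` equals the twisted expectation, in any other plane `q'`, of the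
  axis-permuted observable (magnetic-sector means are temporal-sector means of rotated observables).
* `electricSuppression_blindness` (proved) — the arithmetic hinge: if the centre-odd ("electric")
  part of a thermal trace is an `ε`-fraction of the centre-even part, twisted and untwisted
  expectations of a centre-even observable differ by `≤ 4Mε/(1-ε²)`.
* `softSplit_sum` (proved) — the positive-type partition of unity on `SU(2)` subordinate to the two
  `ℤ₂`-cosets, `φ(U) + φ(-U) = 1` with `φ(U) = (2 + Re tr U)/4 = cos²(ψ/2)`, which makes the
  "soft cover" plaquette weight `w·φ` positive AND of positive type (reflection positivity survives).
-/

noncomputable section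

open MeasureTheory

namespace Summit.QuantumFields.YangMills.Cruxes.NonSimplyConnectedLatticeGap.ThooftRotationBlindness

open Literature.MathematicalPhysics.QuantumFieldTheory

/-- Coordinate planes of the four-torus. -/
abbrev Plane4 : Type := {p : Fin 4 × Fin 4 // p.1 < p.2}

section Defs

variable {G : Type} [Group G] [TopologicalSpace G] [IsTopologicalGroup G] [CompactSpace G]
  [MeasurableSpace G] [BorelSpace G] {N : ℕ}

/-- Expectation of `F` under the Wilson weight with plaquette insertion `t`
(`exp(-β S_t) ∏ dU_e`, normalised by `insertedPartitionFunction`). For `t = stackInsertion z q a b`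
this is the expectation in the `z`-twisted sector of plane `q` of the covering theory. -/
def twistedExpectation (ρ : G →* Matrix (Fin N) (Fin N) ℂ) (β : ℝ) (L : ℕ) [NeZero L]
    (t : Plaquette 4 L → G) (F : GaugeConfig 4 L G → ℝ) : ℝ :=
  (∫ U : GaugeConfig 4 L G, F U * Real.exp (-(β * insertedWilsonAction ρ t U))
      ∂(Measure.pi fun _ : Edge 4 L => haarProbability G)) / insertedPartitionFunction ρ β L t

end Defs

/-- **'t Hooft's Euclidean covariance of twist weights** (lattice form of the 90°-rotation
"duality", 't Hooft 1979 §X (10.3); Greensite 2011 §4.4): on the symmetric torus `(ℤ/L)^4` the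
twisted partition function is independent of the twisted plane. In particular the weight of a
MAGNETIC twist `(i,j)` equals the weight of a TEMPORAL twist `(0,i)`. Expected proof: axis
permutation `configPerm π` (`wilsonMeasure_map_configPerm`-style change of variables), orientation
reversal handled by `twistedPartitionFunction_inv`, stack moved back by
`twistedPartitionFunctionAt_eq`. -/
def TwistWeightPlaneIndependent : Prop :=
  ∀ (G : Type) [Group G] [TopologicalSpace G] [IsTopologicalGroup G] [CompactSpace G]
    [MeasurableSpace G] [BorelSpace G] (N : ℕ) (ρ : G →* Matrix (Fin N) (Fin N) ℂ),
    Continuous ρ → ∀ z : G, z ∈ Subgroup.center G → ∀ (β : ℝ) (L : ℕ) [NeZero L]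
    (q q' : Plane4), twistedPartitionFunction ρ β L z q = twistedPartitionFunction ρ β L z q'

/-- **FIRST LEMMA (twist–plane exchange for observables).** For every pair of planes `q, q'` of
the symmetric four-torus there is an axis permutation `π` and a stack position `(a, b)` such that
for every bounded measurable observable `F`, the `z`-twisted expectation of `F` in plane `q` equals
the `z`-twisted expectation in plane `q'` of `F ∘ configPerm π`. With `q` spatial–spatial
(magnetic sector of the time-`0` slicing) and `q'` containing the time axis (temporal twist =
centre-symmetry insertion `Ω_i` in the transfer-matrix trace), this converts magnetic-sector
blindness of local observables into electric-flux suppression. -/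
def TwistPlaneExchange : Prop :=
  ∀ (G : Type) [Group G] [TopologicalSpace G] [IsTopologicalGroup G] [CompactSpace G]
    [MeasurableSpace G] [BorelSpace G] (N : ℕ) (ρ : G →* Matrix (Fin N) (Fin N) ℂ),
    Continuous ρ → ∀ z : G, z ∈ Subgroup.center G → ∀ (β : ℝ) (L : ℕ) [NeZero L]
    (q q' : Plane4), ∃ (π : Equiv.Perm (Fin 4)) (a b : ZMod L),
      ∀ F : GaugeConfig 4 L G → ℝ, Measurable F → (∃ M : ℝ, ∀ U, |F U| ≤ M) →
        twistedExpectation ρ β L (stackInsertion z q 0 0) F =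
          twistedExpectation ρ β L (stackInsertion z q' a b) (F ∘ configPerm π)

/-- **Electric suppression ⇒ twist blindness (the arithmetic hinge, proved).**
Read `Zp = Tr_{e=0}(T^L)`, `Zm = Tr_{e=1}(T^L) ≥ 0` (thermal traces of the positive transfer
matrix on the centre-even / centre-odd subspaces of the covering theory), `ap = Tr_{e=0}(T^L A)`,
`am = Tr_{e=1}(T^L A)` for a centre-even observable with `‖A‖ ≤ M`. The untwisted expectation is
`(ap + am)/(Zp + Zm)`, the temporally twisted one `(ap - am)/(Zp - Zm)` (insertion of the centre
symmetry `Ω`, eigenvalue `(-1)^e`). If the odd trace is an `ε`-fraction of the even one, the two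
expectations differ by at most `4Mε/(1-ε²)`. -/
theorem electricSuppression_blindness {Zp Zm ap am M ε : ℝ} (hZp : 0 < Zp) (hZm : 0 ≤ Zm)
    (hε : Zm ≤ ε * Zp) (hε1 : ε < 1) (hM : 0 ≤ M) (hap : |ap| ≤ M * Zp) (ham : |am| ≤ M * Zm) :
    |(ap - am) / (Zp - Zm) - (ap + am) / (Zp + Zm)| ≤ 4 * M * ε / (1 - ε ^ 2) := by
  have hε0 : 0 ≤ ε := by
    by_contra h
    push Not at h
    have : Zm < 0 := lt_of_le_of_lt hε (by nlinarith)
    linarith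
  have hZmZp : Zm < Zp := lt_of_le_of_lt hε (by nlinarith)
  have hden1 : 0 < Zp - Zm := by linarith
  have hden2 : 0 < Zp + Zm := by linarith
  have hden : 0 < 1 - ε ^ 2 := by nlinarith
  have key : (ap - am) / (Zp - Zm) - (ap + am) / (Zp + Zm) =
      (2 * ap * Zm - 2 * am * Zp) / ((Zp - Zm) * (Zp + Zm)) := by
    field_simp
    ring
  rw [key, abs_div, abs_of_pos (mul_pos hden1 hden2)]
  rw [div_le_div_iff₀ (mul_pos hden1 hden2) hden]
  have hap' : |ap| * Zm ≤ M * Zp * Zm := mul_le_mul_of_nonneg_right hap hZm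
  have ham' : |am| * Zp ≤ M * Zm * Zp := mul_le_mul_of_nonneg_right ham hZp.le
  have hnum : |2 * ap * Zm - 2 * am * Zp| ≤ 4 * M * Zp * Zm := by
    calc |2 * ap * Zm - 2 * am * Zp| ≤ |2 * ap * Zm| + |2 * am * Zp| := abs_sub _ _
      _ = 2 * (|ap| * Zm) + 2 * (|am| * Zp) := by
          rw [abs_mul, abs_mul, abs_mul, abs_mul, abs_of_nonneg hZm, abs_of_pos hZp]
          norm_num
          ring
      _ ≤ 2 * (M * Zp * Zm) + 2 * (M * Zm * Zp) := by linarith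
      _ = 4 * M * Zp * Zm := by ring
  have hprod : (Zp - Zm) * (Zp + Zm) = Zp ^ 2 - Zm ^ 2 := by ring
  calc |2 * ap * Zm - 2 * am * Zp| * (1 - ε ^ 2) ≤ 4 * M * Zp * Zm * (1 - ε ^ 2) :=
        mul_le_mul_of_nonneg_right hnum hden.le
    _ ≤ 4 * M * ε * ((Zp - Zm) * (Zp + Zm)) := by
        rw [hprod]
        have h1 : Zm * (1 - ε ^ 2) ≤ ε * Zp - ε * Zm ^ 2 / Zp := by
          have hZm2 : Zm ^ 2 ≤ ε ^ 2 * Zp ^ 2 := by nlinarith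
          have : ε * Zm ^ 2 / Zp ≤ ε * (ε ^ 2 * Zp ^ 2) / Zp :=
            div_le_div_of_nonneg_right (mul_le_mul_of_nonneg_left hZm2 hε0) hZp.le
          have h2 : ε * (ε ^ 2 * Zp ^ 2) / Zp = ε ^ 3 * Zp := by
            field_simp
          nlinarith [mul_nonneg hε0 (sq_nonneg Zm)]
        have h3 : 4 * M * Zp * (ε * Zp - ε * Zm ^ 2 / Zp) = 4 * M * ε * (Zp ^ 2 - Zm ^ 2) := by
          field_simp
        calc 4 * M * Zp * Zm * (1 - ε ^ 2) = 4 * M * Zp * (Zm * (1 - ε ^ 2)) := by ring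
          _ ≤ 4 * M * Zp * (ε * Zp - ε * Zm ^ 2 / Zp) :=
              mul_le_mul_of_nonneg_left h1 (by positivity)
          _ = 4 * M * ε * (Zp ^ 2 - Zm ^ 2) := h3

/-- The positive-type soft split of `SU(2) → SO(3)`: `φ(M) = (2 + Re tr M)/4` (`= cos²(ψ/2)` on
`SU(2)`, character expansion `½χ₀ + ¼χ_{1/2}` with non-negative coefficients). -/
def softSplit (M : Matrix (Fin 2) (Fin 2) ℂ) : ℝ := (2 + M.trace.re) / 4

/-- `φ(U) + φ(-U) = 1`: the two `ℤ₂`-cosets share the unit weight exactly (proved; pure algebra).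
Consequence used by the line: `exp(β Re tr r(π U_p)) = w⁺(U_p) + w⁺(-U_p)` with the centre-SENSITIVE,
positive, positive-type weight `w⁺ = exp(β Re tr r∘π) · φ`, so the `(G̃, r∘π)` theory is an exact
mixture of `ℤ₂`-inserted "soft cover" theories, each reflection positive. -/
theorem softSplit_sum (M : Matrix (Fin 2) (Fin 2) ℂ) : softSplit M + softSplit (-M) = 1 := by
  simp only [softSplit, Matrix.trace_neg, Complex.neg_re]
  ring

end Summit.QuantumFields.YangMills.Cruxes.NonSimplyConnectedLatticeGap.ThooftRotationBlindness

end
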